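import Literature.NumberTheory.EllipticCurves.FunctionFieldEllipticL
import Mathlib.Analysis.Meromorphic.Order
import Mathlib.Analysis.Analytic.Polynomial
import Mathlib.Analysis.Complex.CauchyIntegral
import Mathlib.Analysis.SpecialFunctions.Pow.Deriv
import HarnessLib

/-!
# `L(E, s)` over a global function field: well-definedness of the continuation and the analytic
# half of rationality

Sibling proof file (D-0014) of `Literature.NumberTheory.EllipticCurves.FunctionFieldEllipticL`
(namespace `Literature.FunctionField`), written in the provefact pass on `HasLContinuation`. It is
sorry-free and declares theorems only.

## What is proved

* `eventuallyEq_of_mem_lContinuations_holds` — **discharge** of the named fact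
  `eventuallyEq_of_mem_lContinuations W` of the parent file: any two admissible continuations of
  the Euler product (members of `lContinuations W`: meromorphic on `ℂ`, analytic at `1`, equal to
  the Euler product on `re s > 3/2`) agree on a neighbourhood of `s = 1`. Proof: their difference
  is meromorphic on the preconnected set `ℂ` and vanishes near `s = 2`, so by Mathlib's identity
  principle for meromorphic functions (`MeromorphicOn.meromorphicOrderAt_ne_top_of_isPreconnected`)
  its meromorphic order at `1` is `⊤`, i.e. it vanishes on a punctured neighbourhood of `1`; it is
  continuous at `1`, hence vanishes at `1` too. No hypothesis on `F` or `W` is involved: this fact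
  was correctly stated for an arbitrary field.
* `analyticRank_eq_analyticOrderNatAt_of_mem_lContinuations`,
  `leadingLCoeff_eq_of_mem_lContinuations` — consequently `analyticRank W = ord_{s=1} g` and
  `leadingLCoeff W = g^{(r)}(1)/r!` for *every* admissible continuation `g`; the classical choice
  made in `lFunction` is harmless.
* `mem_lContinuations_of_eq_rational`, `hasLContinuation_of_eq_rational`,
  `isRational_lFunction_of_eq_rational` — the *analytic half* of Grothendieck rationality: if the
  Euler product equals `P(q^{-s})/Q(q^{-s})` on `re s > 3/2` for integer polynomials `P, Q` with
  `Q(q⁻¹) ≠ 0` (`q ≥ 1`), then `s ↦ P(q^{-s})/Q(q^{-s})` is an admissible continuation (entire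
  numerator and denominator, `analyticAt_aeval_natCast_cpow_neg`; `MeromorphicAt.div`,
  `AnalyticAt.div`), hence `HasLContinuation W` and, with `q = #Fq`, `isRational_lFunction Fq W`.

## `HasLContinuation` as a provefact target (triage)

`HasLContinuation W := (lContinuations W).Nonempty` is the *predicate* consumed by `lFunction` and
`lFunction_mem_lContinuations`, on a Weierstrass curve `W` over an arbitrary field `F : Type`; it
is not a closed theorem. As recorded in the parent file (section "Corrected statements and proved
reductions"), its closure over all `F`, `W` is not the cited result — at a number field `F`,
`Place F` is the set of finite places, `ellLFunction W` is the Hasse–Weil Euler product on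
`re s > 3/2`, and `HasLContinuation W` for elliptic `W` is the Hasse–Weil conjecture
(continuation to `ℂ`, holomorphic at `s = 1`), open beyond the modular cases. The theorem of the
source — Ulmer, *Park City lectures on elliptic curves over function fields* (2011), Lecture 1,
§9 (arXiv p. 18: "Because of the Hasse bound … the product converges absolutely in the region
`Re s > 3/2`, and … it has a meromorphic continuation to all `s`"; the constant case in the
exercise preceding Thm. 9.3; **Thm. 9.3** (Grothendieck, Deligne): for non-constant `E`,
`L(E, s)` is a polynomial in `q^{-s}` of degree `4g - 4 + deg 𝔫`; "Note that in all cases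
`L(E, s)` is holomorphic at `s = 1`") — is `HasLContinuation W` for `W` elliptic over a *global
function field*, i.e. exactly the corrected named fact `hasLContinuation_of_functionField Fq W`
of the parent file (body `∀ [W.IsElliptic], HasLContinuation W`, the function-field structure
`[Field Fq] [Fintype Fq] [Algebra Fq[X] F] [Algebra (RatFunc Fq) F]
[IsScalarTower Fq[X] (RatFunc Fq) F] [FunctionField Fq F]` as binders).

Its discharge is Grothendieck's cohomological rationality theorem (Grothendieck–Lefschetz trace
formula for the `ℓ`-adic sheaf `j_* V_ℓ(E)` on the base curve, Deligne purity for the poles; the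
constant case via Weil's theorem), a theory not available over Mathlib (no étale cohomology, no
`ℓ`-adic Galois representations on Tate modules over global function fields). What is available
is the DAG

  `hasLContinuation_of_functionField Fq W`
    `⇐ isRational_lFunction_of_functionField Fq W`
        (parent file, `hasLContinuation_of_functionField_of_isRational_lFunction`)
    `⇐` "Euler product `= P(q^{-s})/Q(q^{-s})` on `re s > 3/2`, `Q(q⁻¹) ≠ 0`"
        (this file, `isRational_lFunction_of_eq_rational` with
        `isRational_lFunction_of_functionField_iff`)
    `⇐` Grothendieck–Lefschetz + Deligne (absent),

so that only the arithmetic identity on the half-plane of absolute convergence remains between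
the library and Ulmer's Theorem 9.3.

## References

* [Ulmer2011ParkCity] D. Ulmer, *Park City lectures on elliptic curves over function fields*,
  IAS/Park City Math. Ser. 18 (2011), Lecture 1, §9 and Thm. 9.3 (numbering of the arXiv
  version 1101.1939, as in the parent file).
* [Tate1966Bourbaki] J. Tate, *On the conjectures of Birch and Swinnerton-Dyer and a geometric
  analog*, Sém. Bourbaki 306 (1966), §1.
-/

noncomputable section

open scoped Classical Polynomial

namespace Literature.NumberTheory.EllipticCurves.FunctionField

open Complex Filter Topology Polynomial

section IdentityPrinciple

variable {F : Type} [Field F] (W : WeierstrassCurve F)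

/-- **Discharge of `eventuallyEq_of_mem_lContinuations`.** Any two admissible continuations of
the Euler product `L(E, s)` agree on a neighbourhood of `s = 1`: their difference is meromorphic
on the preconnected set `ℂ` and vanishes identically near `s = 2` (both agree with the Euler
product on the open half-plane `re s > 3/2`), so by the identity principle for meromorphic
functions its meromorphic order is `⊤` everywhere, i.e. it vanishes on a punctured neighbourhood
of `1`; being analytic (hence continuous) at `1` it vanishes at `1` as well.
Ulmer (2011), Lecture 1, §9 (the continuation of `L(E, s)` is well defined).
[cite: Ulmer2011ParkCity, Lect. 1, §9] -/
theorem eventuallyEq_of_mem_lContinuations_holds : eventuallyEq_of_mem_lContinuations W := by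
  intro g₁ g₂ h₁ h₂
  obtain ⟨hm₁, ha₁, he₁⟩ := h₁
  obtain ⟨hm₂, ha₂, he₂⟩ := h₂
  set h : ℂ → ℂ := g₁ - g₂ with hh
  have hmer : MeromorphicOn h Set.univ := fun x hx => (hm₁ x hx).sub (hm₂ x hx)
  -- `h` vanishes near `2`, a point of the open half-plane of agreement
  have h2 : meromorphicOrderAt h 2 = ⊤ := by
    rw [meromorphicOrderAt_eq_top_iff]
    have hopen : IsOpen {s : ℂ | (3 / 2 : ℝ) < s.re} :=
      isOpen_lt continuous_const Complex.continuous_re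
    have hmem : (2 : ℂ) ∈ {s : ℂ | (3 / 2 : ℝ) < s.re} := by
      simp only [Set.mem_setOf_eq]
      norm_num
    have : ∀ᶠ z in 𝓝 (2 : ℂ), h z = 0 := by
      filter_upwards [hopen.mem_nhds hmem] with z hz
      simp [hh, he₁ z hz, he₂ z hz]
    exact this.filter_mono nhdsWithin_le_nhds
  -- identity principle: the order is `⊤` at `1` as well
  have h1 : meromorphicOrderAt h 1 = ⊤ := by
    by_contra hne
    exact hmer.meromorphicOrderAt_ne_top_of_isPreconnected isPreconnected_univ (Set.mem_univ _)
      (Set.mem_univ _) hne h2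
  rw [meromorphicOrderAt_eq_top_iff] at h1
  -- continuity at `1` gives the value at `1`
  have hcont : ContinuousAt h 1 := (ha₁.sub ha₂).continuousAt
  have h1val : h 1 = 0 := by
    have t1 : Tendsto h (𝓝[≠] (1 : ℂ)) (𝓝 (h 1)) := hcont.tendsto.mono_left nhdsWithin_le_nhds
    have t2 : Tendsto h (𝓝[≠] (1 : ℂ)) (𝓝 0) :=
      tendsto_const_nhds.congr' (h1.mono fun z hz => hz.symm)
    exact tendsto_nhds_unique t1 t2
  have key : ∀ᶠ z in 𝓝 (1 : ℂ), h z = 0 := by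
    rw [eventually_nhdsWithin_iff] at h1
    filter_upwards [h1] with z hz
    by_cases hz1 : z = 1
    · rw [hz1]; exact h1val
    · exact hz hz1
  filter_upwards [key] with z hz
  simpa [hh, sub_eq_zero] using hz

/-- The analytic rank `ord_{s=1} L(E, s)` may be computed from *any* admissible continuation `g`
of the Euler product (choice-independence of `analyticRank`, from
`eventuallyEq_of_mem_lContinuations_holds` and `analyticOrderAt_congr`).
Ulmer (2011), Lecture 1, §§9–10. [cite: Ulmer2011ParkCity, Lect. 1, §9] -/
theorem analyticRank_eq_analyticOrderNatAt_of_mem_lContinuations {g : ℂ → ℂ}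
    (hg : g ∈ lContinuations W) : analyticRank W = analyticOrderNatAt g 1 := by
  have h : HasLContinuation W := ⟨g, hg⟩
  have heq := eventuallyEq_of_mem_lContinuations_holds W (lFunction_mem_lContinuations W h) hg
  unfold analyticRank analyticOrderNatAt
  rw [analyticOrderAt_congr heq]

/-- The leading Taylor coefficient `L^*(E, 1)` may be computed from *any* admissible continuation
`g` of the Euler product: `leadingLCoeff W = g^{(r)}(1) / r!` with `r = ord_{s=1} g`
(choice-independence of `leadingLCoeff`, from `eventuallyEq_of_mem_lContinuations_holds` and
`Filter.EventuallyEq.iteratedDeriv_eq`). Ulmer (2011), Lecture 1, §§9–11 (`L^*(E,1)`).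
[cite: Ulmer2011ParkCity, Lect. 1, §9] -/
theorem leadingLCoeff_eq_of_mem_lContinuations {g : ℂ → ℂ} (hg : g ∈ lContinuations W) :
    leadingLCoeff W =
      iteratedDeriv (analyticOrderNatAt g 1) g 1 / ((analyticOrderNatAt g 1).factorial : ℂ) := by
  have h : HasLContinuation W := ⟨g, hg⟩
  have heq := eventuallyEq_of_mem_lContinuations_holds W (lFunction_mem_lContinuations W h) hg
  unfold leadingLCoeff
  rw [analyticRank_eq_analyticOrderNatAt_of_mem_lContinuations W hg, heq.iteratedDeriv_eq]

end IdentityPrinciple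

section Rational

variable {F : Type} [Field F] (W : WeierstrassCurve F)

/-- `s ↦ q^{-s}` is an entire function for a natural number `q ≥ 1` (`q^{-s} = exp (-s log q)`).
[folklore] -/
theorem analyticAt_natCast_cpow_neg {q : ℕ} (hq : q ≠ 0) (z : ℂ) :
    AnalyticAt ℂ (fun s : ℂ => (q : ℂ) ^ (-s)) z :=
  (differentiable_id.neg.const_cpow (Or.inl (Nat.cast_ne_zero.mpr hq))).analyticAt z

/-- For an integer polynomial `P` and `q ≥ 1`, `s ↦ P(q^{-s})` is entire. [folklore] -/
theorem analyticAt_aeval_natCast_cpow_neg {q : ℕ} (hq : q ≠ 0) (P : ℤ[X]) (z : ℂ) :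
    AnalyticAt ℂ (fun s : ℂ => aeval ((q : ℂ) ^ (-s)) P) z :=
  (analyticAt_natCast_cpow_neg hq z).aeval_polynomial P

/-- **The analytic half of Grothendieck rationality.** Let `q ≥ 1` and `P, Q ∈ ℤ[T]` with
`Q(q⁻¹) ≠ 0`. If the Euler product `L(E, s)` equals `P(q^{-s}) / Q(q^{-s})` on the half-plane
`re s > 3/2`, then `s ↦ P(q^{-s}) / Q(q^{-s})` is an admissible continuation of `L(E, s)`: it is
meromorphic on `ℂ` (quotient of entire functions; at the zeros of the denominator it takes
Mathlib's junk value `x / 0 = 0`, immaterial for `MeromorphicAt`), analytic at `s = 1` because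
`Q(q^{-1}) ≠ 0`, and agrees with the Euler product where required. This isolates the arithmetic
content of Ulmer (2011), Lecture 1, Thm. 9.3 (Grothendieck, Deligne: `L(E, s)` *is* such a
rational function of `q^{-s}`, holomorphic at `s = 1`) from the complex analysis.
[cite: Ulmer2011ParkCity, Lect. 1, §9, Thm. 9.3] -/
theorem mem_lContinuations_of_eq_rational {q : ℕ} (hq : q ≠ 0) (P Q : ℤ[X])
    (hQ : aeval ((q : ℂ) ^ (-(1 : ℂ))) Q ≠ 0)
    (hL : ∀ s : ℂ, (3 / 2 : ℝ) < s.re →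
      ellLFunction W s = aeval ((q : ℂ) ^ (-s)) P / aeval ((q : ℂ) ^ (-s)) Q) :
    (fun s : ℂ => aeval ((q : ℂ) ^ (-s)) P / aeval ((q : ℂ) ^ (-s)) Q) ∈ lContinuations W := by
  refine ⟨?_, ?_, fun s hs => (hL s hs).symm⟩
  · intro z _
    exact (analyticAt_aeval_natCast_cpow_neg hq P z).meromorphicAt.div
      (analyticAt_aeval_natCast_cpow_neg hq Q z).meromorphicAt
  · exact (analyticAt_aeval_natCast_cpow_neg hq P 1).div
      (analyticAt_aeval_natCast_cpow_neg hq Q 1) hQ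

/-- If the Euler product `L(E, s)` is a rational function `P(q^{-s}) / Q(q^{-s})` on `re s > 3/2`
with `Q(q⁻¹) ≠ 0` (`q ≥ 1`), then `HasLContinuation W` (`mem_lContinuations_of_eq_rational`).
For an elliptic curve over a global function field the hypothesis is Grothendieck's theorem,
Ulmer (2011), Lecture 1, §9 and Thm. 9.3. [cite: Ulmer2011ParkCity, Lect. 1, §9, Thm. 9.3] -/
theorem hasLContinuation_of_eq_rational {q : ℕ} (hq : q ≠ 0) (P Q : ℤ[X])
    (hQ : aeval ((q : ℂ) ^ (-(1 : ℂ))) Q ≠ 0)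
    (hL : ∀ s : ℂ, (3 / 2 : ℝ) < s.re →
      ellLFunction W s = aeval ((q : ℂ) ^ (-s)) P / aeval ((q : ℂ) ^ (-s)) Q) :
    HasLContinuation W :=
  ⟨_, mem_lContinuations_of_eq_rational W hq P Q hQ hL⟩

/-- With `q = #Fq` the same hypothesis — the Euler product of `W` equals `P(q^{-s}) / Q(q^{-s})`
on `re s > 3/2`, `Q(q⁻¹) ≠ 0` — yields the rationality fact `isRational_lFunction Fq W` of the
parent file (and hence, over a global function field, `isRational_lFunction_of_functionField`
by `isRational_lFunction_of_functionField_iff`, then `hasLContinuation_of_functionField` by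
`hasLContinuation_of_functionField_of_isRational_lFunction`). This is the exact arithmetic
residue of Ulmer (2011), Lecture 1, Thm. 9.3 left to a trace-formula theory.
[cite: Ulmer2011ParkCity, Lect. 1, §9, Thm. 9.3] -/
theorem isRational_lFunction_of_eq_rational (Fq : Type) [Fintype Fq] [Nonempty Fq] (P Q : ℤ[X])
    (hQ : aeval ((Fintype.card Fq : ℂ) ^ (-(1 : ℂ))) Q ≠ 0)
    (hL : ∀ s : ℂ, (3 / 2 : ℝ) < s.re →
      ellLFunction W s = aeval ((Fintype.card Fq : ℂ) ^ (-s)) P /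
        aeval ((Fintype.card Fq : ℂ) ^ (-s)) Q) :
    isRational_lFunction Fq W := by
  intro _
  refine ⟨P, Q, ?_, mem_lContinuations_of_eq_rational W Fintype.card_ne_zero P Q hQ hL⟩
  rintro rfl
  exact hQ (by simp)

end Rational

end Literature.NumberTheory.EllipticCurves.FunctionField

end
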